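import Mathlib
import Summits.MatrixMultiplication.MatrixMultiplication.Theses.SuccinctSecantEquations

/-!
# Line `seed-tensorise` for crux `SuccinctSeparation` (stmt-MatrixMultiplication-7986)

The crux-strategist's decomposition of the RESTATED deciding crux, as a registered skeleton.  Self-contained:
§A reproduces verbatim the published crux workfile `Cruxes/SuccinctSeparation/Split.lean` (the PROVED split glue
`SuccinctSeparation_of_subs : SuccinctSeparationBeyondConstants → SuccinctSeparationProductLaw → SuccinctSeparation`,
Fekete iteration, sorry-free), so that this file elaborates without importing `Cruxes` modules.

Notation.  `N = n²`; a *succinct separation at `(n, r, s)`* is a polynomial `F` on `ℂ^N ⊗ ℂ^N ⊗ ℂ^N` (variables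
indexed by `(Fin n × Fin n)³`) of fan-in-two circuit size `complexity F ≤ s`, vanishing on every tensor of rank `≤ r`
(so on the secant variety `σ_r`) and non-zero at `⟨n,n,n⟩` — a succinct certificate of `bR(⟨n,n,n⟩) > r`.

§B/§C — FOUR registered stubs (statements as `def`s), two per piece of the split:

* piece 1 `SuccinctSeparationBeyondConstants` (`∃ a ∀ K ∃ n ≥ K ∃ r ≥ K n²`, succinct separation at `(n, r, n^a)`):
  - `stub_rankMethodBeyondConstants` (HARDEST; the open content of piece 1 through its only known mechanism): one
    exponent `a` such that for every `K` some format `n ≥ K` carries a polynomial matrix `Φ ∈ Mat_{P×Q}(ℂ[x])`,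
    `P, Q ≤ n^a`, entries of circuit size `≤ n^a`, whose evaluated rank is `≤ g` on every tensor of rank `≤ r`
    (some `r ≥ K n²`) and `> g` at `⟨n,n,n⟩`.  For `K ≥ 6` the entries cannot all be linear (cactus barrier,
    `Literature.Barriers.MatrixMultiplication.LinearRankMethodBarrier`, Buczynski2026); the only nonlinear engine in
    print (DolezalekMichalek2026, tangency flattenings) reaches `r ≈ N`; record `2n² − ⌈log₂ n⌉ − 1`
    (LandsbergMichalek2018, linear Koszul flattening); first open rung `K = 2`.
  - `stub_minorExtraction` (provable, L): a non-vanishing `(g+1)`-minor of `Φ(⟨n,n,n⟩)` is a succinct separation —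
    determinant of a `(g+1) × (g+1)` matrix of size-`n^a` polynomials, `g < Q ≤ n^a`, has circuit size `≤ n^b` by the
    tree's Berkowitz bound `complexity_detPoly_le` (`8(g+2)⁷`) and the substitution bound `complexity_aeval_le`.
* piece 2 `SuccinctSeparationProductLaw` (succinct separations TENSORISE along `⟨nm⟩ = ⟨n⟩ ⊠ ⟨m⟩`: level `⌊r r'/k⌋`,
  size `≤ max(A·s·s', (nm)^a)`), cut along LEVEL ∧ SIZE:
  - `stub_levelLaw` (geometry, size-free conclusion): levels `r, r'` carried by succinct separations of `⟨n⟩`, `⟨m⟩`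
    multiply up to a constant `k_a` — SOME polynomial separates `σ_{⌊rr'/k⌋}` from `⟨nm⟩` (i.e. `bR(⟨nm⟩) > rr'/k`).
    Restricted to succinctly-certified levels on purpose: the unrestricted law `bR(⟨n⟩)·bR(⟨m⟩) ≤ k·bR(⟨nm⟩)` is
    equivalent to ATTAINMENT of `ω` by border rank up to the constant `k` (`bR(⟨N⟩) ≤ k N^ω` for all `N`, by
    squaring + `bR(⟨N⟩) ≤ N^{ω+o(1)}`), an InfimumNotMinimum-type bet (catalogue entry
    `Literature.Barriers.MatrixMultiplication.InfimumNotMinimumBarrier`: `bR(⟨N⟩) > N^ω` strictly) nobody should stake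
    a line on.  Border rank itself is strictly submultiplicative already at `⟨2⟩ ⊠ ⟨2⟩` (`bR(⟨2⟩)² = 49 > 48 ≥ R(⟨4⟩)`,
    DumasPernetSedoglavic2025; in general arXiv:1801.04852), so the constant `k` absorbs what multiplicativity of `bR`
    cannot give; whether `k = 1` fails for CERTIFIED levels is open even at `n = m = 2` (it needs `bR(⟨4⟩) ≤ 36`;
    known `29 ≤ bR(⟨4⟩) ≤ 48`).
  - `stub_succinctLift` (complexity, the size clause): below the product level `L ≤ r r'`, separability in principle
    of `σ_L` from `⟨nm⟩` plus succinct certificates for the factors give a succinct separation at level `⌊L/k'⌋`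
    within the product-law budget `max(A·s·s', (nm)^a)`.  Known rung: `⌊L/k'⌋ < (nm)²` and `a ≥ 15` (flattening
    minors, `complexity_detPoly_le`).
Compositions (§D, kernel-checked, no sorry outside the stubs): `beyondConstants_of` (stubs 1+2 ⇒ piece 1, run the
method at `max K 2`), `productLaw_of` (stubs 3+4 ⇒ piece 2, `k := k_a·k'_a`, `⌊⌊rr'/k⌋/k'⌋ = ⌊rr'/(kk')⌋`), and
`SuccinctSeparation_of` (the four stub statements ⇒ the crux BY NAME, through §A).
-/

set_option linter.dupNamespace false

noncomputable section

namespace Summit.MatrixMultiplication.MatrixMultiplication.Cruxes.SuccinctSeparation.SeedTensorise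

open Literature.Computability.AlgebraicComplexity
open Summit.MatrixMultiplication.MatrixMultiplication.Theses.SuccinctSecantEquations (SuccinctSeparation)

/-- Polynomials on `ℂ^{n²} ⊗ ℂ^{n²} ⊗ ℂ^{n²}` (the format of `⟨n,n,n⟩`). -/
local notation "Poly[" n "]" =>
  MvPolynomial ((Fin n × Fin n) × (Fin n × Fin n) × (Fin n × Fin n)) ℂ

set_option quotPrecheck false in
/-- `F` vanishes on every tensor of rank `≤ r` of format `(Fin n × Fin n)³`. -/
local notation "Vanish[" n ", " r ", " F "]" =>
  ∀ T : Fin n × Fin n → Fin n × Fin n → Fin n × Fin n → ℂ, tensorRank T ≤ r →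
    MvPolynomial.eval (fun p => T p.1 p.2.1 p.2.2) F = 0

set_option quotPrecheck false in
/-- `F` does not vanish at the matrix multiplication tensor `⟨n,n,n⟩`. -/
local notation "AtMM[" n ", " F "]" =>
  MvPolynomial.eval (fun p => matMulTensor ℂ n n n p.1 p.2.1 p.2.2) F ≠ 0

/-! ## §A  The split glue — verbatim from `Cruxes/SuccinctSeparation/Split.lean` (PROVED) -/

/-! ## Transport of a succinct separation along an equality of formats -/

/-- A succinct separation at `(n, r, s)` is one at `(n', r, s')` whenever `n = n'` and `s ≤ s'`
(the variable type `(Fin n × Fin n)³` depends on `n`, so the format is moved by `subst`). [folklore] -/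
theorem split_transport {n n' : ℕ} (h : n = n') {r s s' : ℕ} (hs : s ≤ s')
    (hsep : ∃ F : Poly[n], complexity F ≤ s ∧ Vanish[n, r, F] ∧ AtMM[n, F]) :
    ∃ F : Poly[n'], complexity F ≤ s' ∧ Vanish[n', r, F] ∧ AtMM[n', F] := by
  subst h
  obtain ⟨F, hc, hv, hm⟩ := hsep
  exact ⟨F, hc.trans hs, hv, hm⟩

/-! ## The Fekete iteration along `n₀^{j+2} = n₀^{j+1} · n₀` -/

/-- FEKETE ITERATION.  From a seed separation at `(n₀, r₀, ≤ n₀^a)` with `n₀ ≥ 2`, `A ≤ n₀`,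
`3·n₀²·k ≤ r₀`, and the product law at exponent `a+1` with constants `(k, A)`, every level `j` carries a
succinct separation at `(n₀^{j+1}, R, ≤ (n₀^{j+1})^{a+1})` with `(3n₀²)^{j+1} ≤ R`. [folklore] -/
theorem split_iter (n₀ r₀ k A a : ℕ) (hn₀ : 2 ≤ n₀) (hA : A ≤ n₀) (hk : 0 < k)
    (hr₀ : 3 * n₀ ^ 2 * k ≤ r₀)
    (hseed : ∃ F : Poly[n₀], complexity F ≤ n₀ ^ a ∧ Vanish[n₀, r₀, F] ∧ AtMM[n₀, F])
    (hlaw : ∀ (n m r r' : ℕ) (F : Poly[n]) (F' : Poly[m]), 2 ≤ n → 2 ≤ m → n ^ 2 ≤ r → m ^ 2 ≤ r' →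
      complexity F ≤ n ^ (a + 1) → complexity F' ≤ m ^ (a + 1) →
      Vanish[n, r, F] → AtMM[n, F] → Vanish[m, r', F'] → AtMM[m, F'] →
      ∃ G : Poly[n * m], complexity G ≤ max (A * complexity F * complexity F') ((n * m) ^ (a + 1)) ∧
        Vanish[n * m, r * r' / k, G] ∧ AtMM[n * m, G])
    (j : ℕ) :
    ∃ R : ℕ, (3 * n₀ ^ 2) ^ (j + 1) ≤ R ∧
      ∃ G : Poly[n₀ ^ (j + 1)], complexity G ≤ (n₀ ^ (j + 1)) ^ (a + 1) ∧
        Vanish[n₀ ^ (j + 1), R, G] ∧ AtMM[n₀ ^ (j + 1), G] := by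
  have h1 : 1 ≤ n₀ := le_trans (by norm_num) hn₀
  have hsq : n₀ ^ 2 ≤ 3 * n₀ ^ 2 * k := by
    calc n₀ ^ 2 = 1 * n₀ ^ 2 * 1 := by ring
      _ ≤ 3 * n₀ ^ 2 * k := Nat.mul_le_mul (Nat.mul_le_mul (by norm_num) le_rfl) hk
  have hr₀' : n₀ ^ 2 ≤ r₀ := hsq.trans hr₀
  have hdiv : 3 * n₀ ^ 2 ≤ r₀ / k := (Nat.le_div_iff_mul_le hk).2 hr₀
  obtain ⟨F₀, hF₀c, hF₀v, hF₀m⟩ := hseed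
  have hF₀c' : complexity F₀ ≤ n₀ ^ (a + 1) :=
    hF₀c.trans (Nat.pow_le_pow_right h1 (Nat.le_succ a))
  induction j with
  | zero =>
    refine ⟨r₀, ?_, ?_⟩
    · calc (3 * n₀ ^ 2) ^ (0 + 1) = 3 * n₀ ^ 2 * 1 := by ring
        _ ≤ 3 * n₀ ^ 2 * k := Nat.mul_le_mul_left _ hk
        _ ≤ r₀ := hr₀
    · refine split_transport (pow_one n₀).symm ?_ ⟨F₀, hF₀c, hF₀v, hF₀m⟩
      rw [zero_add, pow_one]
      exact Nat.pow_le_pow_right h1 (Nat.le_succ a)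
  | succ j ih =>
    obtain ⟨R, hR, G, hGc, hGv, hGm⟩ := ih
    -- guards for the law at (n₀^{j+1}, R) ⊠ (n₀, r₀)
    have hn : 2 ≤ n₀ ^ (j + 1) := le_trans hn₀ (Nat.le_self_pow (Nat.succ_ne_zero j) n₀)
    have hRsq : (n₀ ^ (j + 1)) ^ 2 ≤ R := by
      calc (n₀ ^ (j + 1)) ^ 2 = (n₀ ^ 2) ^ (j + 1) := by rw [← pow_mul, ← pow_mul, mul_comm]
        _ ≤ (3 * n₀ ^ 2) ^ (j + 1) := Nat.pow_le_pow_left (by omega) _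
        _ ≤ R := hR
    obtain ⟨G', hG'c, hG'v, hG'm⟩ :=
      hlaw (n₀ ^ (j + 1)) n₀ R r₀ G F₀ hn hn₀ hRsq hr₀' hGc hF₀c' hGv hGm hF₀v hF₀m
    refine ⟨R * r₀ / k, ?_, ?_⟩
    · -- level: (3n₀²)^{j+2} = (3n₀²)^{j+1}·(3n₀²) ≤ R·⌊r₀/k⌋ ≤ ⌊R r₀/k⌋
      calc (3 * n₀ ^ 2) ^ (j + 1 + 1) = (3 * n₀ ^ 2) ^ (j + 1) * (3 * n₀ ^ 2) := pow_succ _ _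
        _ ≤ R * (r₀ / k) := Nat.mul_le_mul hR hdiv
        _ ≤ R * r₀ / k := Nat.mul_div_le_mul_div_assoc R r₀ k
    · -- size: A·(n₀^{j+1})^{a+1}·n₀^a ≤ (n₀^{j+1})^{a+1}·n₀^{a+1} = (n₀^{j+2})^{a+1}, using A ≤ n₀
      refine split_transport (pow_succ n₀ (j + 1)).symm ?_ ⟨G', hG'c, hG'v, hG'm⟩
      refine max_le ?_ (by rw [← pow_succ])
      calc A * complexity G * complexity F₀
          ≤ n₀ * (n₀ ^ (j + 1)) ^ (a + 1) * n₀ ^ a :=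
            Nat.mul_le_mul (Nat.mul_le_mul hA hGc) hF₀c
        _ = (n₀ ^ (j + 1) * n₀) ^ (a + 1) := by ring
        _ = (n₀ ^ (j + 1 + 1)) ^ (a + 1) := by rw [← pow_succ]

/-! ## The split -/

/-- **The strategist's split of `SuccinctSeparation`** (BC2 redirect of the RESTATED deciding crux of route
`SuccinctSecantEquations`): SUCCINCT SEPARATION BEYOND CONSTANTS (`∃ a ∀ K ∃ n ≥ K ∃ r ≥ K n²`, a size-`n^a`
polynomial vanishing on all tensors of rank `≤ r` and not at `⟨n,n,n⟩`) and the SUCCINCT SEPARATION PRODUCT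
LAW (such separations tensorise along `⟨nm⟩ = ⟨n⟩ ⊠ ⟨m⟩` with level `⌊r r'/k⌋` and size
`≤ max(A·s·s', (nm)^a)`) together
imply `SuccinctSeparation` with `δ = log_{n₀} 2`, `C = a + 1`: Fekete iteration `split_iter` along the powers
of one seed size `n₀`, then `(n₀^{j+1})^{2+δ} = (2n₀²)^{j+1} ≤ (3n₀²)^{j+1}`.  The two hypotheses are the
children `SuccinctSeparationBeyondConstants`, `SuccinctSeparationProductLaw` verbatim. [folklore] -/
theorem SuccinctSeparation_of_subs
    (h₁ : ∃ a : ℕ, ∀ K : ℕ, ∃ n r : ℕ, K ≤ n ∧ K * n ^ 2 ≤ r ∧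
      ∃ F : MvPolynomial ((Fin n × Fin n) × (Fin n × Fin n) × (Fin n × Fin n)) ℂ,
        Literature.Computability.AlgebraicComplexity.complexity F ≤ n ^ a ∧
        (∀ T : Fin n × Fin n → Fin n × Fin n → Fin n × Fin n → ℂ,
          Literature.Computability.AlgebraicComplexity.tensorRank T ≤ r →
            MvPolynomial.eval (fun p => T p.1 p.2.1 p.2.2) F = 0) ∧
        MvPolynomial.eval (fun p =>
          Literature.Computability.AlgebraicComplexity.matMulTensor ℂ n n n p.1 p.2.1 p.2.2) F ≠ 0)
    (h₂ : ∀ a : ℕ, ∃ k : ℕ, 0 < k ∧ ∃ A : ℕ, ∀ (n m r r' : ℕ)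
      (F : MvPolynomial ((Fin n × Fin n) × (Fin n × Fin n) × (Fin n × Fin n)) ℂ)
      (F' : MvPolynomial ((Fin m × Fin m) × (Fin m × Fin m) × (Fin m × Fin m)) ℂ),
      2 ≤ n → 2 ≤ m → n ^ 2 ≤ r → m ^ 2 ≤ r' →
      Literature.Computability.AlgebraicComplexity.complexity F ≤ n ^ a →
      Literature.Computability.AlgebraicComplexity.complexity F' ≤ m ^ a →
      (∀ T : Fin n × Fin n → Fin n × Fin n → Fin n × Fin n → ℂ,
        Literature.Computability.AlgebraicComplexity.tensorRank T ≤ r →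
          MvPolynomial.eval (fun p => T p.1 p.2.1 p.2.2) F = 0) →
      MvPolynomial.eval (fun p =>
        Literature.Computability.AlgebraicComplexity.matMulTensor ℂ n n n p.1 p.2.1 p.2.2) F ≠ 0 →
      (∀ T : Fin m × Fin m → Fin m × Fin m → Fin m × Fin m → ℂ,
        Literature.Computability.AlgebraicComplexity.tensorRank T ≤ r' →
          MvPolynomial.eval (fun p => T p.1 p.2.1 p.2.2) F' = 0) →
      MvPolynomial.eval (fun p =>
        Literature.Computability.AlgebraicComplexity.matMulTensor ℂ m m m p.1 p.2.1 p.2.2) F' ≠ 0 →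
      ∃ G : MvPolynomial ((Fin (n * m) × Fin (n * m)) × (Fin (n * m) × Fin (n * m)) ×
          (Fin (n * m) × Fin (n * m))) ℂ,
        Literature.Computability.AlgebraicComplexity.complexity G ≤
            max (A * Literature.Computability.AlgebraicComplexity.complexity F *
              Literature.Computability.AlgebraicComplexity.complexity F') ((n * m) ^ a) ∧
        (∀ T : Fin (n * m) × Fin (n * m) → Fin (n * m) × Fin (n * m) → Fin (n * m) × Fin (n * m) → ℂ,
          Literature.Computability.AlgebraicComplexity.tensorRank T ≤ r * r' / k →
            MvPolynomial.eval (fun p => T p.1 p.2.1 p.2.2) G = 0) ∧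
        MvPolynomial.eval (fun p =>
          Literature.Computability.AlgebraicComplexity.matMulTensor ℂ (n * m) (n * m) (n * m)
            p.1 p.2.1 p.2.2) G ≠ 0) :
    SuccinctSeparation := by
  -- (i) constants: `a` from the seed statement, `(k, A)` from the law at exponent `a + 1`, one seed at
  -- `K = 3k + A + 2` (so `n₀ ≥ 2`, `A ≤ n₀`, `3k·n₀² ≤ r₀`).
  obtain ⟨a, hseed⟩ := h₁
  obtain ⟨k, hk, A, hlaw⟩ := h₂ (a + 1)
  obtain ⟨n₀, r₀, hKn, hKr, F₀, hF₀c, hF₀v, hF₀m⟩ := hseed (3 * k + A + 2)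
  have hn₀ : 2 ≤ n₀ := by omega
  have hA : A ≤ n₀ := by omega
  have hr₀ : 3 * n₀ ^ 2 * k ≤ r₀ := by
    calc 3 * n₀ ^ 2 * k = (3 * k) * n₀ ^ 2 := by ring
      _ ≤ (3 * k + A + 2) * n₀ ^ 2 := Nat.mul_le_mul_right _ (by omega)
      _ ≤ r₀ := hKr
  -- (ii) the real exponent: `δ = log_{n₀} 2 > 0`, `n₀^δ = 2`.
  have hn₀R : (1 : ℝ) < n₀ := by exact_mod_cast (lt_of_lt_of_le one_lt_two hn₀)
  have hn₀pos : (0 : ℝ) < n₀ := lt_trans one_pos hn₀R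
  have hδpos : 0 < Real.logb n₀ 2 := Real.logb_pos hn₀R one_lt_two
  have hpowδ : (n₀ : ℝ) ^ Real.logb n₀ 2 = 2 := Real.rpow_logb hn₀pos (ne_of_gt hn₀R) two_pos
  refine ⟨Real.logb n₀ 2, hδpos, a + 1, fun N₀ => ?_⟩
  -- (iii) level `N₀` of the Fekete iteration.
  obtain ⟨R, hR, G, hGc, hGv, hGm⟩ :=
    split_iter n₀ r₀ k A a hn₀ hA hk hr₀ ⟨F₀, hF₀c, hF₀v, hF₀m⟩ hlaw N₀
  refine ⟨n₀ ^ (N₀ + 1), ?_, R, ?_, G, hGc, hGv, hGm⟩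
  · -- `N₀ ≤ 2^{N₀} ≤ n₀^{N₀} ≤ n₀^{N₀+1}`
    calc N₀ ≤ 2 ^ N₀ := Nat.lt_two_pow_self.le
      _ ≤ n₀ ^ N₀ := Nat.pow_le_pow_left hn₀ N₀
      _ ≤ n₀ ^ (N₀ + 1) := Nat.pow_le_pow_right (by omega) (Nat.le_succ _)
  · -- `(n₀^{N₀+1})^{2+δ} = (n₀^{2+δ})^{N₀+1} = (2 n₀²)^{N₀+1} ≤ (3 n₀²)^{N₀+1} ≤ R`
    have h0 : (0 : ℝ) ≤ n₀ := hn₀pos.le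
    have hbase : (n₀ : ℝ) ^ ((2 : ℝ) + Real.logb n₀ 2) = 2 * (n₀ : ℝ) ^ 2 := by
      rw [Real.rpow_add hn₀pos, hpowδ, Real.rpow_two]; ring
    have key : ((n₀ : ℝ) ^ (N₀ + 1)) ^ ((2 : ℝ) + Real.logb n₀ 2)
        = (2 * (n₀ : ℝ) ^ 2) ^ (N₀ + 1) := by
      have e1 : ((n₀ : ℝ) ^ (N₀ + 1)) = (n₀ : ℝ) ^ ((N₀ + 1 : ℕ) : ℝ) :=
        (Real.rpow_natCast _ _).symm
      rw [e1, ← Real.rpow_mul h0, mul_comm, Real.rpow_mul h0, Real.rpow_natCast, hbase]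
    push_cast
    rw [key]
    calc (2 * (n₀ : ℝ) ^ 2) ^ (N₀ + 1) ≤ (3 * (n₀ : ℝ) ^ 2) ^ (N₀ + 1) := by
          gcongr; norm_num
      _ ≤ (R : ℝ) := by exact_mod_cast hR

/-! ## §B  Statements (pieces verbatim; stub statements) -/

/-- Piece 1 of the split, verbatim: SUCCINCT SEPARATION BEYOND CONSTANTS. -/
def SuccinctSeparationBeyondConstants : Prop := ∃ a : ℕ, ∀ K : ℕ, ∃ n r : ℕ, K ≤ n ∧ K * n ^ 2 ≤ r ∧ ∃ F : MvPolynomial ((Fin n × Fin n) × (Fin n × Fin n) × (Fin n × Fin n)) ℂ, Literature.Computability.AlgebraicComplexity.complexity F ≤ n ^ a ∧ (∀ T : Fin n × Fin n → Fin n × Fin n → Fin n × Fin n → ℂ, Literature.Computability.AlgebraicComplexity.tensorRank T ≤ r → MvPolynomial.eval (fun p => T p.1 p.2.1 p.2.2) F = 0) ∧ MvPolynomial.eval (fun p => Literature.Computability.AlgebraicComplexity.matMulTensor ℂ n n n p.1 p.2.1 p.2.2) F ≠ 0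

/-- Piece 2 of the split, verbatim: SUCCINCT SEPARATION PRODUCT LAW. -/
def SuccinctSeparationProductLaw : Prop := ∀ a : ℕ, ∃ k : ℕ, 0 < k ∧ ∃ A : ℕ, ∀ (n m r r' : ℕ) (F : MvPolynomial ((Fin n × Fin n) × (Fin n × Fin n) × (Fin n × Fin n)) ℂ) (F' : MvPolynomial ((Fin m × Fin m) × (Fin m × Fin m) × (Fin m × Fin m)) ℂ), 2 ≤ n → 2 ≤ m → n ^ 2 ≤ r → m ^ 2 ≤ r' → Literature.Computability.AlgebraicComplexity.complexity F ≤ n ^ a → Literature.Computability.AlgebraicComplexity.complexity F' ≤ m ^ a → (∀ T : Fin n × Fin n → Fin n × Fin n → Fin n × Fin n → ℂ, Literature.Computability.AlgebraicComplexity.tensorRank T ≤ r → MvPolynomial.eval (fun p => T p.1 p.2.1 p.2.2) F = 0) → MvPolynomial.eval (fun p => Literature.Computability.AlgebraicComplexity.matMulTensor ℂ n n n p.1 p.2.1 p.2.2) F ≠ 0 → (∀ T : Fin m × Fin m → Fin m × Fin m → Fin m × Fin m → ℂ, Literature.Computability.AlgebraicComplexity.tensorRank T ≤ r' → MvPolynomial.eval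 (fun p => T p.1 p.2.1 p.2.2) F' = 0) → MvPolynomial.eval (fun p => Literature.Computability.AlgebraicComplexity.matMulTensor ℂ m m m p.1 p.2.1 p.2.2) F' ≠ 0 → ∃ G : MvPolynomial ((Fin (n * m) × Fin (n * m)) × (Fin (n * m) × Fin (n * m)) × (Fin (n * m) × Fin (n * m))) ℂ, Literature.Computability.AlgebraicComplexity.complexity G ≤ max (A * Literature.Computability.AlgebraicComplexity.complexity F * Literature.Computability.AlgebraicComplexity.complexity F') ((n * m) ^ a) ∧ (∀ T : Fin (n * m) × Fin (n * m) → Fin (n * m) × Fin (n * m) → Fin (n * m) × Fin (n * m) → ℂ, Literature.Computability.AlgebraicComplexity.tensorRank T ≤ r * r' / k → MvPolynomial.eval (fun p => T p.1 p.2.1 p.2.2) G = 0) ∧ MvPolynomial.eval (fun p => Literature.Computability.AlgebraicComplexity.matMulTensor ℂ (n * m) (n * m) (n * m) p.1 p.2.1 p.2.2) G ≠ 0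

/-- Stub 1 statement: a SUCCINCT POLYNOMIAL RANK METHOD beyond every constant multiple of `n²`, at `⟨n,n,n⟩`. -/
def RankMethodBeyondConstants : Prop :=
  ∃ a : ℕ, ∀ K : ℕ, ∃ n r P Q g : ℕ, K ≤ n ∧ K * n ^ 2 ≤ r ∧ P ≤ n ^ a ∧ Q ≤ n ^ a ∧
    ∃ Φ : Matrix (Fin P) (Fin Q) (MvPolynomial ((Fin n × Fin n) × (Fin n × Fin n) × (Fin n × Fin n)) ℂ),
      (∀ i j, Literature.Computability.AlgebraicComplexity.complexity (Φ i j) ≤ n ^ a) ∧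
      (∀ T : Fin n × Fin n → Fin n × Fin n → Fin n × Fin n → ℂ,
        Literature.Computability.AlgebraicComplexity.tensorRank T ≤ r →
          (Φ.map (MvPolynomial.eval (fun p => T p.1 p.2.1 p.2.2))).rank ≤ g) ∧
      g < (Φ.map (MvPolynomial.eval (fun p =>
        Literature.Computability.AlgebraicComplexity.matMulTensor ℂ n n n p.1 p.2.1 p.2.2))).rank

/-- Stub 2 statement: MINORS OF SUCCINCT RANK METHODS ARE SUCCINCT SEPARATIONS (one output exponent `b` per input
exponent `a`). -/
def MinorExtraction : Prop :=
  ∀ a : ℕ, ∃ b : ℕ, ∀ (n r P Q g : ℕ)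
    (Φ : Matrix (Fin P) (Fin Q) (MvPolynomial ((Fin n × Fin n) × (Fin n × Fin n) × (Fin n × Fin n)) ℂ)),
    2 ≤ n → P ≤ n ^ a → Q ≤ n ^ a →
    (∀ i j, Literature.Computability.AlgebraicComplexity.complexity (Φ i j) ≤ n ^ a) →
    (∀ T : Fin n × Fin n → Fin n × Fin n → Fin n × Fin n → ℂ,
      Literature.Computability.AlgebraicComplexity.tensorRank T ≤ r →
        (Φ.map (MvPolynomial.eval (fun p => T p.1 p.2.1 p.2.2))).rank ≤ g) →
    g < (Φ.map (MvPolynomial.eval (fun p =>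
      Literature.Computability.AlgebraicComplexity.matMulTensor ℂ n n n p.1 p.2.1 p.2.2))).rank →
    ∃ F : MvPolynomial ((Fin n × Fin n) × (Fin n × Fin n) × (Fin n × Fin n)) ℂ,
      Literature.Computability.AlgebraicComplexity.complexity F ≤ n ^ b ∧
      (∀ T : Fin n × Fin n → Fin n × Fin n → Fin n × Fin n → ℂ,
        Literature.Computability.AlgebraicComplexity.tensorRank T ≤ r →
          MvPolynomial.eval (fun p => T p.1 p.2.1 p.2.2) F = 0) ∧
      MvPolynomial.eval (fun p =>
        Literature.Computability.AlgebraicComplexity.matMulTensor ℂ n n n p.1 p.2.1 p.2.2) F ≠ 0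

/-- Stub 3 statement: the LEVEL LAW (size-free conclusion) — levels carried by succinct separations of `⟨n⟩` and `⟨m⟩`
multiply up to a constant `k_a`: SOME polynomial separates `σ_{⌊r r'/k⌋}` from `⟨nm, nm, nm⟩`. -/
def LevelLaw : Prop :=
  ∀ a : ℕ, ∃ k : ℕ, 0 < k ∧ ∀ (n m r r' : ℕ)
    (F : MvPolynomial ((Fin n × Fin n) × (Fin n × Fin n) × (Fin n × Fin n)) ℂ)
    (F' : MvPolynomial ((Fin m × Fin m) × (Fin m × Fin m) × (Fin m × Fin m)) ℂ),
    2 ≤ n → 2 ≤ m → n ^ 2 ≤ r → m ^ 2 ≤ r' →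
    Literature.Computability.AlgebraicComplexity.complexity F ≤ n ^ a →
    Literature.Computability.AlgebraicComplexity.complexity F' ≤ m ^ a →
    (∀ T : Fin n × Fin n → Fin n × Fin n → Fin n × Fin n → ℂ,
      Literature.Computability.AlgebraicComplexity.tensorRank T ≤ r →
        MvPolynomial.eval (fun p => T p.1 p.2.1 p.2.2) F = 0) →
    MvPolynomial.eval (fun p =>
      Literature.Computability.AlgebraicComplexity.matMulTensor ℂ n n n p.1 p.2.1 p.2.2) F ≠ 0 →
    (∀ T : Fin m × Fin m → Fin m × Fin m → Fin m × Fin m → ℂ,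
      Literature.Computability.AlgebraicComplexity.tensorRank T ≤ r' →
        MvPolynomial.eval (fun p => T p.1 p.2.1 p.2.2) F' = 0) →
    MvPolynomial.eval (fun p =>
      Literature.Computability.AlgebraicComplexity.matMulTensor ℂ m m m p.1 p.2.1 p.2.2) F' ≠ 0 →
    ∃ G₀ : MvPolynomial ((Fin (n * m) × Fin (n * m)) × (Fin (n * m) × Fin (n * m)) ×
        (Fin (n * m) × Fin (n * m))) ℂ,
      (∀ T : Fin (n * m) × Fin (n * m) → Fin (n * m) × Fin (n * m) → Fin (n * m) × Fin (n * m) → ℂ,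
        Literature.Computability.AlgebraicComplexity.tensorRank T ≤ r * r' / k →
          MvPolynomial.eval (fun p => T p.1 p.2.1 p.2.2) G₀ = 0) ∧
      MvPolynomial.eval (fun p =>
        Literature.Computability.AlgebraicComplexity.matMulTensor ℂ (n * m) (n * m) (n * m)
          p.1 p.2.1 p.2.2) G₀ ≠ 0

/-- Stub 4 statement: the SUCCINCT LIFT (the size clause) — below the product level `L ≤ r r'`, separability in
principle of `σ_L` from `⟨nm⟩` plus succinct certificates for the factors give a succinct separation at level
`⌊L/k⌋` within the product-law budget `max(A·s·s', (nm)^a)`. -/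
def SuccinctLift : Prop :=
  ∀ a : ℕ, ∃ k : ℕ, 0 < k ∧ ∃ A : ℕ, ∀ (n m r r' L : ℕ)
    (F : MvPolynomial ((Fin n × Fin n) × (Fin n × Fin n) × (Fin n × Fin n)) ℂ)
    (F' : MvPolynomial ((Fin m × Fin m) × (Fin m × Fin m) × (Fin m × Fin m)) ℂ),
    2 ≤ n → 2 ≤ m → n ^ 2 ≤ r → m ^ 2 ≤ r' →
    Literature.Computability.AlgebraicComplexity.complexity F ≤ n ^ a →
    Literature.Computability.AlgebraicComplexity.complexity F' ≤ m ^ a →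
    (∀ T : Fin n × Fin n → Fin n × Fin n → Fin n × Fin n → ℂ,
      Literature.Computability.AlgebraicComplexity.tensorRank T ≤ r →
        MvPolynomial.eval (fun p => T p.1 p.2.1 p.2.2) F = 0) →
    MvPolynomial.eval (fun p =>
      Literature.Computability.AlgebraicComplexity.matMulTensor ℂ n n n p.1 p.2.1 p.2.2) F ≠ 0 →
    (∀ T : Fin m × Fin m → Fin m × Fin m → Fin m × Fin m → ℂ,
      Literature.Computability.AlgebraicComplexity.tensorRank T ≤ r' →
        MvPolynomial.eval (fun p => T p.1 p.2.1 p.2.2) F' = 0) →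
    MvPolynomial.eval (fun p =>
      Literature.Computability.AlgebraicComplexity.matMulTensor ℂ m m m p.1 p.2.1 p.2.2) F' ≠ 0 →
    L ≤ r * r' →
    (∃ G₀ : MvPolynomial ((Fin (n * m) × Fin (n * m)) × (Fin (n * m) × Fin (n * m)) ×
        (Fin (n * m) × Fin (n * m))) ℂ,
      (∀ T : Fin (n * m) × Fin (n * m) → Fin (n * m) × Fin (n * m) → Fin (n * m) × Fin (n * m) → ℂ,
        Literature.Computability.AlgebraicComplexity.tensorRank T ≤ L →
          MvPolynomial.eval (fun p => T p.1 p.2.1 p.2.2) G₀ = 0) ∧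
      MvPolynomial.eval (fun p =>
        Literature.Computability.AlgebraicComplexity.matMulTensor ℂ (n * m) (n * m) (n * m)
          p.1 p.2.1 p.2.2) G₀ ≠ 0) →
    ∃ G : MvPolynomial ((Fin (n * m) × Fin (n * m)) × (Fin (n * m) × Fin (n * m)) ×
        (Fin (n * m) × Fin (n * m))) ℂ,
      Literature.Computability.AlgebraicComplexity.complexity G ≤
          max (A * Literature.Computability.AlgebraicComplexity.complexity F *
            Literature.Computability.AlgebraicComplexity.complexity F') ((n * m) ^ a) ∧
      (∀ T : Fin (n * m) × Fin (n * m) → Fin (n * m) × Fin (n * m) → Fin (n * m) × Fin (n * m) → ℂ,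
        Literature.Computability.AlgebraicComplexity.tensorRank T ≤ L / k →
          MvPolynomial.eval (fun p => T p.1 p.2.1 p.2.2) G = 0) ∧
      MvPolynomial.eval (fun p =>
        Literature.Computability.AlgebraicComplexity.matMulTensor ℂ (n * m) (n * m) (n * m)
          p.1 p.2.1 p.2.2) G ≠ 0

/-! ## §C  Registered stubs -/

/-- STUB 1 (hardest; the open content of piece 1): a succinct polynomial rank method beyond every constant. -/
theorem stub_rankMethodBeyondConstants : RankMethodBeyondConstants := by
  sorry

/-- STUB 2 (provable, L): a non-vanishing `(g+1)`-minor at `⟨n,n,n⟩` of a succinct rank method is a succinct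
separation (Berkowitz `complexity_detPoly_le` + substitution `complexity_aeval_le`). -/
theorem stub_minorExtraction : MinorExtraction := by
  sorry

/-- STUB 3 (open; geometry): the level law — succinctly certified levels multiply up to a constant at `⟨nm⟩`. -/
theorem stub_levelLaw : LevelLaw := by
  sorry

/-- STUB 4 (open; complexity): the succinct lift — below the product level, separability in principle plus succinct
factor certificates give a succinct separation with constant level loss. -/
theorem stub_succinctLift : SuccinctLift := by
  sorry

/-! ## §D  Compositions (no `sorry` below this line) -/

/-- Stubs 1 + 2 give piece 1: run the rank method at `max K 2` (so `n ≥ 2`) and extract a minor. [folklore] -/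
theorem beyondConstants_of (h1 : RankMethodBeyondConstants) (h2 : MinorExtraction) :
    SuccinctSeparationBeyondConstants := by
  obtain ⟨a, h⟩ := h1
  obtain ⟨b, hb⟩ := h2 a
  refine ⟨b, fun K => ?_⟩
  obtain ⟨n, r, P, Q, g, hKn, hKr, hP, hQ, Φ, hΦc, hΦr, hΦm⟩ := h (max K 2)
  have hn2 : 2 ≤ n := le_trans (le_max_right K 2) hKn
  obtain ⟨F, hFc, hFv, hFm⟩ := hb n r P Q g Φ hn2 hP hQ hΦc hΦr hΦm
  exact ⟨n, r, le_trans (le_max_left K 2) hKn,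
    le_trans (Nat.mul_le_mul_right _ (le_max_left K 2)) hKr, F, hFc, hFv, hFm⟩

/-- Stubs 3 + 4 give piece 2: with `k := k_a · k'_a`, the level law supplies a separation in principle at level
`⌊r r'/k_a⌋ ≤ r r'`, the succinct lift makes it succinct at level `⌊⌊r r'/k_a⌋/k'_a⌋ = ⌊r r'/(k_a k'_a)⌋`. [folklore] -/
theorem productLaw_of (h3 : LevelLaw) (h4 : SuccinctLift) : SuccinctSeparationProductLaw := by
  intro a
  obtain ⟨k, hk, hlev⟩ := h3 a
  obtain ⟨k', hk', A, hlift⟩ := h4 a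
  refine ⟨k * k', Nat.mul_pos hk hk', A, ?_⟩
  intro n m r r' F F' hn hm hr hr' hcF hcF' hvF hmF hvF' hmF'
  obtain ⟨G₀, hG₀v, hG₀m⟩ := hlev n m r r' F F' hn hm hr hr' hcF hcF' hvF hmF hvF' hmF'
  obtain ⟨G, hGc, hGv, hGm⟩ := hlift n m r r' (r * r' / k) F F' hn hm hr hr' hcF hcF' hvF hmF hvF'
    hmF' (Nat.div_le_self _ _) ⟨G₀, hG₀v, hG₀m⟩
  refine ⟨G, hGc, fun T hT => hGv T ?_, hGm⟩
  rwa [Nat.div_div_eq_div_mul]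

/-- THE LINE: the four stub statements imply the crux `SuccinctSeparation` BY NAME — piece 1 from stubs 1+2, piece 2
from stubs 3+4, glued by the proved split `SuccinctSeparation_of_subs` (§A, Fekete iteration). [folklore] -/
theorem SuccinctSeparation_of :
    RankMethodBeyondConstants → MinorExtraction → LevelLaw → SuccinctLift → SuccinctSeparation :=
  fun h1 h2 h3 h4 => SuccinctSeparation_of_subs (beyondConstants_of h1 h2) (productLaw_of h3 h4)

/-- The crux from the registered stubs by name. [folklore] -/
theorem SuccinctSeparation_holds_of_stubs : SuccinctSeparation :=
  SuccinctSeparation_of stub_rankMethodBeyondConstants stub_minorExtraction stub_levelLaw stub_succinctLift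

end Summit.MatrixMultiplication.MatrixMultiplication.Cruxes.SuccinctSeparation.SeedTensorise

end
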